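import Literature.Computability.Complexity.PCPToCMMSAMachine
import Literature.Computability.Complexity.CMMSASquaringMachine
import Literature.Computability.Complexity.CMMSAPad
import Literature.Computability.Complexity.MCSPHardnessProofsProofs
import Literature.Computability.Complexity.GapAssembly
import HarnessLib

/-!
# `MCSP*` is NP-hard under randomized reductions, from the PCP theorem alone

Topic `Computability/Complexity`. Hirahara's theorem `isRandNPHard_MCSPStar` (`MCSPHardness.lean`;
FOCS 2022, Thm. 1.2 / Thm. 8.5: `MCSP*` is NP-hard under randomized polynomial-time many-one
reductions) from a SINGLE hypothesis on the PCP side — the basic PCP theorem `pcp_theorem_exact`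
(Arora–Barak 2009, Thm. 11.5), or equivalently NP-hardness of `gapE3SAT ε` for some `ε < 1/8`
(its gap form, Thm. 11.9; a fortiori Håstad's Thm. 6.5, `hastad_seven_eighths`, or a gap machine
`GapMachine ε₁` of `GapAssembly.lean`) — in place of the sliding-scale PCP of Hirahara's printed
proof (Lemma 5.3, `Hirahara2022_lem53_logPow_queried`, `MCSPHardnessFromPCP.lean`) or Raz's parallel
repetition theorem (`CMMSAFromLabelCover.lean`). The chain, all proved in the tree:

1. a base rung: an NP-hard constant-gap, constant-degree, soundness-`1` CMMSA problem
   `gapCMMSA g 1 K` with `g > 1` — from a PCP verifier directly (`PCPToCMMSAMachine.lean`: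
   `gapQ q = 1 + 1/(4q+4)`, `K = 2^q·q`) or from gap-E3SAT (`CNFToCMMSAMachine.lean`:
   `baseGap ε = 1 + (1/8-ε)/4`, `K = 3`); both are hitting-set embeddings with polarity weights
   (Alekhnovich–Buss–Moran–Pitassi 2001, §2; Hirahara 2022, proof of Thm. 5.2);
2. self-improvement `gapCMMSA g 1 K ≤ₚ gapCMMSA g² 1 K²`, iterated a constant number `r` of times
   until `g^{2^r} ≥ g₀` (`CMMSASquaringMachine.lean`; ABMP 2001, §2, Lemma 2 and proof of Thm. 3);
3. padding by `2^{K²}` dummy variables to meet the degree bound `Δ(n) = (log n)^{1/2}` of Hirahara's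
   interface (`CMMSAPad.lean`, and `polyTimeReducible_pad` here), and antitonicity in the gap;
4. Hirahara's randomized reduction from `gapCMMSA 107520 1 sqrtLog` to `MCSP*` (Lemma 8.3 / proof of
   Thm. 8.5 at a constant gap: `HiraharaSpecConst.lean`, `MCSPStarFromRedOut.lean`, and the machine
   `HiraharaMachine.redOut_codeFP`), and `IsRandNPHard.of_isNPHard_promise`.

* `CMMSAPad.codeFP_pad`, `CMMSAPad.polyTimeReducible_pad` — the padding of `CMMSAPad.lean` as a Karp
  reduction from the constant degree bound `K` to `sqrtLog`;
* `isNPHard_gapCMMSA_sqrtLog_of_base` — **steps 2–3: from any base rung, `gapCMMSA g₀ 1 sqrtLog` is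
  NP-hard for every constant `g₀`**; `isNPHard_gapCMMSA_const_of_gapE3SAT`,
  `isNPHard_gapCMMSA_const_of_pcp_theorem`;
* `promiseRandReducible_gapCMMSA_const_MCSPStar` — step 4, unconditionally;
* **`isRandNPHard_MCSPStar_of_pcp_theorem`**, **`isRandNPHard_MCSPStar_of_gapE3SAT`**,
  `isRandNPHard_MCSPStar_of_hastad`, `isRandNPHard_MCSPStar_of_gapMachine`, and the companions
  `isRandComplete_NP_MCSPStar_of_pcp_theorem`, `NP_subset_BPP_of_MCSPStar_mem_BPP_of_pcp_theorem`.

## References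

* S. Hirahara, *NP-hardness of learning programs and partial MCSP*, FOCS 2022; ECCC TR22-119,
  Thm. 1.2, Thm. 8.5 and its proof (pp. 30–31), Lemma 8.3, Thm. 5.2 [Hirahara2022PartialMCSP].
* M. Alekhnovich, S. Buss, S. Moran, T. Pitassi, *Minimum propositional proof length is NP-hard to
  linearly approximate*, J. Symbolic Logic 66 (2001) 171–191, §2 (Lemma 2, Thm. 3) [AlekhnovichEtAl2001].
* J. Håstad, *Some optimal inapproximability results*, J. ACM 48 (2001), Thm. 6.5 [Hastad2001].
* S. Arora, B. Barak, *Computational Complexity: A Modern Approach*, CUP 2009, Thm. 11.5, Thm. 11.9,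
  §22.2, §7.6 [AroraBarakCC2009].
-/

namespace Literature.Computability.Complexity

open _root_.Computability MetaComplexity CodeFP
open CSPToCMMSAMachine (TO toE toE_eq)

namespace CMMSAPad

/-! ### Padding is a Karp reduction -/

/-- **Padding is polynomial time on codes.** [cite: AroraBarak2009, §1.3] -/
theorem codeFP_pad (P : ℕ) : CodeFP CMMSAInstance.encoding.encode CMMSAInstance.encoding.encode (padInstance P) := by
  have hT : CodeFP toE toE (fun t : TO => (t.1 + P, t.2.1, t.2.2.1 ++ List.replicate P 0, t.2.2.2)) := by
    have h1 : CodeFP toE natE (fun t => t.1 + P) := natAdd.comp ((fst _ _).pair (const _ P))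
    have h3 : CodeFP toE (listE unE) (fun t => t.2.2.1 ++ List.replicate P 0) :=
      (listOfRaw unE).comp ((rawAppend unE).comp
        (((rawOfList unE).comp (snd _ _).snd'.fst').pair (const _ (List.replicate P 0))))
    exact (h1.pair ((snd _ _).fst'.pair (h3.pair (snd _ _).snd'.snd'))).congr fun _ => rfl
  obtain ⟨f, hf, hfd⟩ := hT
  refine ⟨f, hf, fun I => ?_⟩
  rw [CMMSAInstance.encoding_encode, CMMSAInstance.encoding_encode, toE_eq, hfd]
  rfl

/-- **Constant degree bound to `sqrtLog`**: `gapCMMSA g ε K ≤ₚ gapCMMSA g ε sqrtLog`.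
[cite: Hirahara2022PartialMCSP, Thm. 5.2 (the degree parameter Δ(n) = (log n)^{1/2})] -/
theorem polyTimeReducible_pad (K : ℕ) (g ε : ℝ) :
    (gapCMMSA (fun _ => g) (fun _ => ε) fun _ => K).PolyTimeReducible
      (gapCMMSA (fun _ => g) (fun _ => ε) sqrtLog) := by
  obtain ⟨f, hf, hfI⟩ := codeFP_pad (2 ^ (K ^ 2))
  refine ⟨f, hf, ?_, ?_⟩
  · intro v hv
    rw [gapCMMSA_yes] at hv
    obtain ⟨I, hI, rfl⟩ := hv
    rw [hfI, gapCMMSA_yes]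
    exact Set.mem_image_of_mem _ (pad_mem_yesSet hI)
  · intro v hv
    rw [gapCMMSA_no] at hv
    obtain ⟨I, hI, rfl⟩ := hv
    rw [hfI, gapCMMSA_no]
    exact Set.mem_image_of_mem _ (pad_mem_noSet hI)

end CMMSAPad

/-! ### Constant-gap CMMSA at the degree bound `sqrtLog` from a base rung -/

/-- **From any NP-hard base rung `gapCMMSA g 1 K` with a constant gap `g > 1` and a constant degree
bound `K`, `gapCMMSA g₀ 1 sqrtLog` is NP-hard for every constant `g₀`**: `r` squarings with
`g^{2^r} ≥ g₀`, padding, and antitonicity in the gap. [cite: AlekhnovichEtAl2001, §2 (Lemma 2 and proof of Thm. 3); Hirahara2022PartialMCSP, Def. 5.1 and Thm. 5.2 (Δ(n) = (log n)^{1/2})] -/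
theorem isNPHard_gapCMMSA_sqrtLog_of_base {g : ℝ} (hg : 1 < g) {K : ℕ}
    (h : (gapCMMSA (fun _ => g) (fun _ => 1) fun _ => K).IsNPHard) (g₀ : ℝ) :
    (gapCMMSA (fun _ => g₀) (fun _ => 1) sqrtLog).IsNPHard := by
  obtain ⟨n, hn⟩ := pow_unbounded_of_one_lt g₀ hg
  have hr : g₀ ≤ g ^ (2 ^ n) := hn.le.trans (pow_le_pow_right₀ hg.le Nat.lt_two_pow_self.le)
  have hiter := CMMSASquare.isNPHard_gapCMMSA_iterate hg.le h n
  have hpad := PromiseProblem.IsHard.of_reducible_holds hiter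
    (CMMSAPad.polyTimeReducible_pad (K ^ (2 ^ n)) _ _)
  exact PromiseProblem.IsHard.gapCMMSA_anti hpad (fun _ => hr) (fun _ => le_rfl)

/-- **NP-hardness of `gapCMMSA g₀ 1 sqrtLog` for every constant `g₀`, from NP-hardness of
`gapE3SAT ε` (`ε < 1/8`).** [cite: AlekhnovichEtAl2001, §2; Hastad2001, Thm. 6.5] -/
theorem isNPHard_gapCMMSA_const_of_gapE3SAT {ε : ℚ} (hε : ε < 1 / 8) (h : (gapE3SAT ε).IsNPHard)
    (g₀ : ℝ) : (gapCMMSA (fun _ => g₀) (fun _ => 1) sqrtLog).IsNPHard :=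
  isNPHard_gapCMMSA_sqrtLog_of_base (CNFToCMMSA.one_lt_baseGap hε)
    (CNFToCMMSA.isNPHard_gapCMMSA_base_of_gapE3SAT hε h) g₀

/-- **NP-hardness of `gapCMMSA g₀ 1 sqrtLog` for every constant `g₀`, from the PCP theorem**
(`pcp_theorem_exact`). [cite: AroraBarakCC2009, Thm. 11.5 and Thm. 11.9; AlekhnovichEtAl2001, §2] -/
theorem isNPHard_gapCMMSA_const_of_pcp_theorem (h : pcp_theorem_exact) (g₀ : ℝ) :
    (gapCMMSA (fun _ => g₀) (fun _ => 1) sqrtLog).IsNPHard := by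
  obtain ⟨q, hq⟩ := PCPToCMMSA.isNPHard_gapCMMSA_of_pcp_theorem h
  exact isNPHard_gapCMMSA_sqrtLog_of_base (PCPToCMMSA.one_lt_gapQ q) hq g₀

/-! ### `MCSP*` -/

/-- **Hirahara's randomized reduction at the constant gap `107520`, unconditionally**:
`PromiseRandReducible (gapCMMSA 107520 1 sqrtLog) (ofLanguage MCSP*)` (Lemma 8.3 / proof of Thm.
8.5 at a constant gap, with the machine `HiraharaMachine.redOut_codeFP 1`). [cite: Hirahara2022PartialMCSP, Lemma 8.3 and proof of Thm. 8.5 (MCSP* case, pp. 30–31)] -/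
theorem promiseRandReducible_gapCMMSA_const_MCSPStar :
    PromiseRandReducible (gapCMMSA (fun _ => (107520 : ℝ)) (fun _ => 1) sqrtLog)
      (PromiseProblem.ofLanguage MCSPStar) := by
  obtain ⟨F, hF, hFeq⟩ := HiraharaMachine.redOut_codeFP 1 le_rfl
  exact HiraharaRed.promiseRandReducible_gapCMMSA_const_of_pairFn le_rfl le_rfl le_rfl hF
    (fun I₀ r _ => hFeq (I₀, r)) fun I₀ hwf => HiraharaRed.totCoins_toPInst_le_eval I₀ hwf

/-- **`MCSP*` is NP-hard under randomized reductions if `gapCMMSA 107520 1 sqrtLog` is NP-hard.**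
[cite: Hirahara2022PartialMCSP, proof of Thm. 8.5 (pp. 30–31)] -/
theorem isRandNPHard_MCSPStar_of_isNPHard_gapCMMSA_const
    (h : (gapCMMSA (fun _ => (107520 : ℝ)) (fun _ => 1) sqrtLog).IsNPHard) : isRandNPHard_MCSPStar :=
  IsRandNPHard.of_isNPHard_promise h promiseRandReducible_gapCMMSA_const_MCSPStar

/-- **Hirahara's Thm. 1.2 / 8.5 for `MCSP*` from the NP-hardness of gap-E3SAT** (any `ε < 1/8`).
[cite: Hirahara2022PartialMCSP, Thm. 1.2 and Thm. 8.5; AlekhnovichEtAl2001, §2] -/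
theorem isRandNPHard_MCSPStar_of_gapE3SAT {ε : ℚ} (hε : ε < 1 / 8) (h : (gapE3SAT ε).IsNPHard) :
    isRandNPHard_MCSPStar :=
  isRandNPHard_MCSPStar_of_isNPHard_gapCMMSA_const (isNPHard_gapCMMSA_const_of_gapE3SAT hε h _)

/-- **Hirahara's Thm. 1.2 / 8.5 for `MCSP*` from the PCP theorem** (`pcp_theorem_exact`,
Arora–Barak 2009, Thm. 11.5): `MCSP*` is NP-hard under randomized polynomial-time reductions.
[cite: Hirahara2022PartialMCSP, Thm. 1.2 and Thm. 8.5; AroraBarakCC2009, Thm. 11.5; AlekhnovichEtAl2001, §2] -/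
theorem isRandNPHard_MCSPStar_of_pcp_theorem (h : pcp_theorem_exact) : isRandNPHard_MCSPStar :=
  isRandNPHard_MCSPStar_of_isNPHard_gapCMMSA_const (isNPHard_gapCMMSA_const_of_pcp_theorem h _)

/-- **… from Håstad's theorem** (`hastad_seven_eighths`, at `ε = 1/16`). [cite: Hastad2001, Thm. 6.5; Hirahara2022PartialMCSP, Thm. 1.2] -/
theorem isRandNPHard_MCSPStar_of_hastad (h : hastad_seven_eighths) : isRandNPHard_MCSPStar :=
  isRandNPHard_MCSPStar_of_gapE3SAT (ε := 1 / 16) (by norm_num) (h (1 / 16) (by norm_num))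

/-- **… from a gap machine** (`GapAssembly.lean`: the last link of the tree's proof of the PCP
theorem). [cite: AroraBarakCC2009, Thm. 11.5 and §22.2; Hirahara2022PartialMCSP, Thm. 1.2] -/
theorem isRandNPHard_MCSPStar_of_gapMachine {ε₁ : ℚ} (M : GapMachine ε₁) (hε0 : 0 < ε₁) (hε : ε₁ ≤ 1 / 8) :
    isRandNPHard_MCSPStar :=
  isRandNPHard_MCSPStar_of_gapE3SAT (ε := 1 / 8 - ε₁) (by linarith) (gapE3SAT_isNPHard_of_gapMachine M hε)

/-- The randomized NP-completeness of `MCSP*` from the PCP theorem. [cite: Hirahara2022PartialMCSP, Thm. 1.2 and §1.2 ("MCSP* ∈ NP"); AroraBarakCC2009, Thm. 11.5] -/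
theorem isRandComplete_NP_MCSPStar_of_pcp_theorem (h : pcp_theorem_exact) :
    IsRandComplete Nondeterministic.NP MCSPStar :=
  isRandComplete_NP_MCSPStar_of_isRandNPHard (isRandNPHard_MCSPStar_of_pcp_theorem h)

/-- The randomized NP-completeness of `MCSP*` from the NP-hardness of gap-E3SAT. [cite: Hirahara2022PartialMCSP, Thm. 1.2 and §1.2 ("MCSP* ∈ NP")] -/
theorem isRandComplete_NP_MCSPStar_of_gapE3SAT {ε : ℚ} (hε : ε < 1 / 8) (h : (gapE3SAT ε).IsNPHard) :
    IsRandComplete Nondeterministic.NP MCSPStar :=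
  isRandComplete_NP_MCSPStar_of_isRandNPHard (isRandNPHard_MCSPStar_of_gapE3SAT hε h)

/-- `MCSP* ∈ BPP ⇒ NP ⊆ BPP`, from the PCP theorem. [cite: Hirahara2022PartialMCSP, Thm. 1.2 (p. 5); AroraBarakCC2009, §7.6 and Thm. 11.5] -/
theorem NP_subset_BPP_of_MCSPStar_mem_BPP_of_pcp_theorem (h : pcp_theorem_exact) :
    NP_subset_BPP_of_MCSPStar_mem_BPP :=
  NP_subset_BPP_of_MCSPStar_mem_BPP_of_promiseRandReducible
    (isNPHard_gapCMMSA_const_of_pcp_theorem h _) promiseRandReducible_gapCMMSA_const_MCSPStar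

/-- `MCSP* ∈ BPP ⇒ NP ⊆ BPP`, from the NP-hardness of gap-E3SAT. [cite: Hirahara2022PartialMCSP, Thm. 1.2 (p. 5); AroraBarakCC2009, §7.6] -/
theorem NP_subset_BPP_of_MCSPStar_mem_BPP_of_gapE3SAT {ε : ℚ} (hε : ε < 1 / 8) (h : (gapE3SAT ε).IsNPHard) :
    NP_subset_BPP_of_MCSPStar_mem_BPP :=
  NP_subset_BPP_of_MCSPStar_mem_BPP_of_promiseRandReducible
    (isNPHard_gapCMMSA_const_of_gapE3SAT hε h _) promiseRandReducible_gapCMMSA_const_MCSPStar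

end Literature.Computability.Complexity
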